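import Literature.NumberTheory.LFunctions.SelbergMeanSquareTools
import Literature.NumberTheory.LFunctions.SelbergFujiiPrimeSums
import HarnessLib

/-!
# The mean-square engine for Selberg's approximate formula: Sobolev–Markov in `σ`, Fubini–Cauchy–Schwarz,
# and Selberg's prime polynomials `Σ_p (−log p)^j w(p) p^{−1/2−u−it}`

Topic `Literature/NumberTheory/LFunctions`. Support file of the Selberg–Fujii cluster (`ZeroGaps.lean`):
the real-variable device that controls the dependence of Selberg's prime polynomials on the moving
abscissa `σ_{x,t} = 1/2 + δ(t)` (`SelbergSigmaXT.lean`) in the mean square over `t ∈ [T/2, T]`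
(Selberg, *Contributions* (1946), §6; cf. Titchmarsh §14.22 for the argument under RH, where `δ` is
constant). Everything here is PROVED; the only definition is the Dirichlet polynomial `dirPoly`.

For a function `Q(u)` of the abscissa with derivative `Q'` and `0 < a ≤ d ≤ 1`:

* `norm_sq_le_sobolev_markov` — `‖Q(d)‖² ≤ 2‖Q(a)‖² + 2 ∫_a^1 (d^{m+1}/u^m) ‖Q'(u)‖² du`
  (Sobolev on `[a, d]`, then `1 ≤ (d/u)^m` on `[a, d]`: the moving point `d = δ(t)` now enters only
  through the power `δ(t)^{m+1}`);
* `integral_mul_le_sqrt_mul_sqrt` — Cauchy–Schwarz `∫ φ H ≤ √(∫ φ²) √(∫ H²)` on `[T₁, T₂]`;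
* `integral_mul_integral_le` — Fubini then Cauchy–Schwarz:
  `∫_{T₁}^{T₂} φ(t) ∫_a^b ψ(u) H(u, t) du dt ≤ √Φ ∫_a^b ψ(u) √(G(u)) du` whenever `∫ φ² ≤ Φ` and
  `∫ H(u, ·)² ≤ G(u)`;
* `dirPoly S w j u t = Σ_{n ∈ S} (−log n)^j w(n) n^{−1/2−u} n^{−it}` with `hasDerivAt_dirPoly`
  (`∂_u P_j = P_{j+1}`), `continuous_dirPoly`, `norm_dirPoly_le`, `dirPoly_sub`, `dirPoly_add`, and its mean
  values on `[T/2, T]`: `integral_norm_sq_dirPoly_le` (`S ⊆ [1, N]`: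
  `≤ (T/2 + 8N(1 + log N)) Σ_n log^{2j} n · w(n)² n^{−1−2u}`) and, for `S` the primes `≤ N`,
  `integral_norm_dirPoly_pow_four_le` (`≤ (T/2 + 8N²(1 + log N²)) · 2 (Σ_p …)²`), from
  `SelbergFujiiPrimeSums.lean`.

## References

* A. Selberg, *Contributions to the theory of the Riemann zeta-function*, Arch. Math. Naturvid. 48
  (1946) no. 5, 89–155, §6.
* E. C. Titchmarsh, *The Theory of the Riemann Zeta-Function*, 2nd ed. rev. D. R. Heath-Brown (1986),
  §14.22, §7.2. [cite: Titchmarsh1986, §14.22]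
-/

noncomputable section

open Real MeasureTheory Set Filter Complex intervalIntegral

namespace Literature.NumberTheory.LFunctions

namespace SelbergEngine

/-! ### Bounded measurable functions are interval integrable -/

/-- A measurable function bounded on `(a, b]` is interval integrable on `[a, b]`. [folklore] -/
theorem intervalIntegrable_of_bounded {f : ℝ → ℝ} (hf : Measurable f) {a b M : ℝ} (hab : a ≤ b)
    (hM : ∀ t ∈ Ioc a b, ‖f t‖ ≤ M) : IntervalIntegrable f volume a b := by
  rw [intervalIntegrable_iff_integrableOn_Ioc_of_le hab]
  have hfin : volume (Ioc a b) ≠ ⊤ := by rw [Real.volume_Ioc]; exact ENNReal.ofReal_ne_top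
  exact Measure.integrableOn_of_bounded (M := M) hfin hf.aestronglyMeasurable
    ((ae_restrict_iff' measurableSet_Ioc).2 (ae_of_all _ hM))

/-! ### Cauchy–Schwarz on an interval -/

/-- **Cauchy–Schwarz**: for measurable `f, g ≥ 0` bounded on `(T₁, T₂]`,
`∫_{T₁}^{T₂} f g ≤ √(∫ f²) · √(∫ g²)`. [folklore] -/
theorem integral_mul_le_sqrt_mul_sqrt {T₁ T₂ : ℝ} (hT : T₁ ≤ T₂) {f g : ℝ → ℝ} (hfm : Measurable f)
    (hgm : Measurable g) (hf0 : ∀ t, 0 ≤ f t) (hg0 : ∀ t, 0 ≤ g t) {B : ℝ}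
    (hfB : ∀ t ∈ Ioc T₁ T₂, f t ≤ B) (hgB : ∀ t ∈ Ioc T₁ T₂, g t ≤ B) :
    ∫ t in T₁..T₂, f t * g t ≤
      Real.sqrt (∫ t in T₁..T₂, f t ^ 2) * Real.sqrt (∫ t in T₁..T₂, g t ^ 2) := by
  have hB0 : ∀ t ∈ Ioc T₁ T₂, 0 ≤ B := fun t ht ↦ (hf0 t).trans (hfB t ht)
  have hI2f : IntervalIntegrable (fun t ↦ f t ^ 2) volume T₁ T₂ := by
    refine intervalIntegrable_of_bounded (f := fun t ↦ f t ^ 2) (hfm.pow_const 2) hT (M := B ^ 2)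
      fun t ht ↦ ?_
    rw [Real.norm_eq_abs, abs_of_nonneg (by positivity)]
    exact pow_le_pow_left₀ (hf0 t) (hfB t ht) 2
  have hI2g : IntervalIntegrable (fun t ↦ g t ^ 2) volume T₁ T₂ := by
    refine intervalIntegrable_of_bounded (f := fun t ↦ g t ^ 2) (hgm.pow_const 2) hT (M := B ^ 2)
      fun t ht ↦ ?_
    rw [Real.norm_eq_abs, abs_of_nonneg (by positivity)]
    exact pow_le_pow_left₀ (hg0 t) (hgB t ht) 2
  have hIfg : IntervalIntegrable (fun t ↦ f t * g t) volume T₁ T₂ := by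
    refine intervalIntegrable_of_bounded (f := fun t ↦ f t * g t) (hfm.mul hgm) hT (M := B ^ 2) fun t ht ↦ ?_
    rw [Real.norm_eq_abs, abs_of_nonneg (mul_nonneg (hf0 t) (hg0 t)), pow_two]
    exact mul_le_mul (hfB t ht) (hgB t ht) (hg0 t) (hB0 t ht)
  set X := ∫ t in T₁..T₂, f t * g t with hX
  set F := ∫ t in T₁..T₂, f t ^ 2 with hF
  set G := ∫ t in T₁..T₂, g t ^ 2 with hG
  have hX0 : 0 ≤ X := intervalIntegral.integral_nonneg hT fun t _ ↦ mul_nonneg (hf0 t) (hg0 t)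
  have hF0 : 0 ≤ F := intervalIntegral.integral_nonneg hT fun t _ ↦ by positivity
  have hG0 : 0 ≤ G := intervalIntegral.integral_nonneg hT fun t _ ↦ by positivity
  rw [← Real.sqrt_mul hF0]
  refine SelbergTools.le_sqrt_mul_of_forall hX0 hF0 hG0 fun lam hlam ↦ ?_
  have hpt : ∀ t ∈ Icc T₁ T₂, f t * g t ≤ lam / 2 * f t ^ 2 + g t ^ 2 / (2 * lam) := by
    intro t _
    have h0 : 0 ≤ (lam * f t - g t) ^ 2 := sq_nonneg _
    rw [div_mul_eq_mul_div, div_add_div _ _ (by norm_num) (by positivity), le_div_iff₀ (by positivity)]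
    nlinarith
  calc X ≤ ∫ t in T₁..T₂, (lam / 2 * f t ^ 2 + g t ^ 2 / (2 * lam)) :=
        intervalIntegral.integral_mono_on hT hIfg ((hI2f.const_mul _).add (hI2g.div_const _)) hpt
    _ = lam * F / 2 + G / (2 * lam) := by
        rw [intervalIntegral.integral_add (hI2f.const_mul _) (hI2g.div_const _),
          intervalIntegral.integral_const_mul, intervalIntegral.integral_div, ← hF, ← hG]
        ring

/-! ### Sobolev–Markov in the abscissa -/

/-- **Sobolev–Markov inequality.** Let `Q` have the continuous derivative `Q'` on `[a, 1]`,
`0 < a ≤ d ≤ 1`, `m ∈ ℕ`. Then `‖Q(d)‖² ≤ 2‖Q(a)‖² + 2 ∫_a^1 (d^{m+1}/u^m) ‖Q'(u)‖² du`: by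
`SelbergTools.norm_sq_le_sobolev` on `[a, d]`, `‖Q d‖² ≤ 2‖Q a‖² + 2(d − a)∫_a^d ‖Q'‖²`, and on `[a, d]`
`(d − a) ≤ d ≤ d (d/u)^m`, after which the (non-negative) integrand is integrated over the longer
interval `[a, 1]`. [folklore] -/
theorem norm_sq_le_sobolev_markov {Q Q' : ℝ → ℂ} {a d : ℝ} (ha : 0 < a) (had : a ≤ d) (hd1 : d ≤ 1)
    (hderiv : ∀ u ∈ Icc a 1, HasDerivAt Q (Q' u) u) (hcont : ContinuousOn Q' (Icc a 1)) (m : ℕ) :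
    ‖Q d‖ ^ 2 ≤ 2 * ‖Q a‖ ^ 2 + 2 * ∫ u in a..1, d ^ (m + 1) / u ^ m * ‖Q' u‖ ^ 2 := by
  have hd0 : 0 < d := ha.trans_le had
  -- Sobolev on `[a, d]`
  have hS := SelbergTools.norm_sq_le_sobolev (Q := Q) (Q' := Q') (a := a) (b := d) (σ := d)
    ⟨had, le_rfl⟩ (fun u hu ↦ hderiv u ⟨hu.1, hu.2.trans hd1⟩) (hcont.mono (Icc_subset_Icc_right hd1))
  -- the weight
  have hcw : ContinuousOn (fun u : ℝ ↦ d ^ (m + 1) / u ^ m) (Icc a 1) := by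
    refine ContinuousOn.div continuousOn_const (continuousOn_id.pow m) fun u hu ↦ ?_
    exact pow_ne_zero _ (ha.trans_le hu.1).ne'
  have hcn : ContinuousOn (fun u : ℝ ↦ ‖Q' u‖ ^ 2) (Icc a 1) := (hcont.norm).pow 2
  have hI1 : IntervalIntegrable (fun u ↦ ‖Q' u‖ ^ 2) volume a d :=
    (hcn.mono (Icc_subset_Icc_right hd1)).intervalIntegrable_of_Icc had
  have hIw : IntervalIntegrable (fun u ↦ d ^ (m + 1) / u ^ m * ‖Q' u‖ ^ 2) volume a 1 :=
    (hcw.mul hcn).intervalIntegrable_of_Icc (had.trans hd1)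
  -- `(d - a) ∫_a^d ‖Q'‖² ≤ ∫_a^d (d^{m+1}/u^m) ‖Q'‖²`
  have h1 : (d - a) * ∫ u in a..d, ‖Q' u‖ ^ 2 ≤ ∫ u in a..d, d ^ (m + 1) / u ^ m * ‖Q' u‖ ^ 2 := by
    rw [← intervalIntegral.integral_const_mul]
    refine intervalIntegral.integral_mono_on had (hI1.const_mul _)
      (hIw.mono_set (by rw [uIcc_of_le had, uIcc_of_le (had.trans hd1)]; exact Icc_subset_Icc_right hd1))
      fun u hu ↦ ?_
    have hu0 : 0 < u := ha.trans_le hu.1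
    refine mul_le_mul_of_nonneg_right ?_ (by positivity)
    -- `d - a ≤ d ≤ d^{m+1}/u^m`
    rw [le_div_iff₀ (pow_pos hu0 m), pow_succ]
    calc (d - a) * u ^ m ≤ d * u ^ m :=
          mul_le_mul_of_nonneg_right (by linarith) (pow_nonneg hu0.le m)
      _ ≤ d * d ^ m := mul_le_mul_of_nonneg_left (pow_le_pow_left₀ hu0.le hu.2 m) hd0.le
      _ = d ^ m * d := by ring
  -- extend to `[a, 1]`
  have h2 : ∫ u in a..d, d ^ (m + 1) / u ^ m * ‖Q' u‖ ^ 2 ≤ ∫ u in a..1, d ^ (m + 1) / u ^ m * ‖Q' u‖ ^ 2 := by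
    refine intervalIntegral.integral_mono_interval le_rfl had hd1 ?_ hIw
    rw [Filter.EventuallyLE, ae_restrict_iff' measurableSet_Ioc]
    refine ae_of_all _ fun u hu ↦ ?_
    have hu0 : 0 < u := ha.trans hu.1
    simp only [Pi.zero_apply]
    positivity
  linarith

/-! ### Fubini, then Cauchy–Schwarz -/

/-- **Fubini–Cauchy–Schwarz.** Let `φ ≥ 0` be measurable and bounded, `ψ ≥ 0` measurable, bounded and
continuous on `[a, b]`, `H ≥ 0` jointly continuous, `T₁ ≤ T₂`, `a ≤ b`. If `∫_{T₁}^{T₂} φ² ≤ Φ` and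
`∫_{T₁}^{T₂} H(u, t)² dt ≤ G(u)` for `u ∈ [a, b]` with `G` continuous on `[a, b]`, then
`∫_{T₁}^{T₂} φ(t) (∫_a^b ψ(u) H(u,t) du) dt ≤ √Φ · ∫_a^b ψ(u) √(G(u)) du`
(swap the integrals — the integrand is bounded and measurable on the rectangle — and apply
Cauchy–Schwarz in `t` for each `u`). [folklore] -/
theorem integral_mul_integral_le {T₁ T₂ a b : ℝ} (hT : T₁ ≤ T₂) (hab : a ≤ b)
    {φ : ℝ → ℝ} (hφm : Measurable φ) (hφ0 : ∀ t, 0 ≤ φ t) {Bφ : ℝ} (hφB : ∀ t, φ t ≤ Bφ)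
    {ψ : ℝ → ℝ} (hψm : Measurable ψ) (hψc : ContinuousOn ψ (Icc a b)) (hψ0 : ∀ u ∈ Icc a b, 0 ≤ ψ u)
    {Bψ : ℝ} (hψB : ∀ u ∈ Icc a b, ψ u ≤ Bψ)
    {H : ℝ → ℝ → ℝ} (hH : Continuous (Function.uncurry H)) (hH0 : ∀ u t, 0 ≤ H u t)
    {Φ : ℝ} (hΦ : ∫ t in T₁..T₂, φ t ^ 2 ≤ Φ)
    {G : ℝ → ℝ} (hG : ContinuousOn G (Icc a b)) (hHG : ∀ u ∈ Icc a b, ∫ t in T₁..T₂, H u t ^ 2 ≤ G u) :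
    ∫ t in T₁..T₂, φ t * ∫ u in a..b, ψ u * H u t ≤
      Real.sqrt Φ * ∫ u in a..b, ψ u * Real.sqrt (G u) := by
  -- a bound for `H` on the rectangle
  obtain ⟨BH, hBH⟩ := (isCompact_Icc.prod isCompact_Icc : IsCompact (Icc a b ×ˢ Icc T₁ T₂)).exists_bound_of_continuousOn
    hH.continuousOn
  have hBH' : ∀ u ∈ Icc a b, ∀ t ∈ Icc T₁ T₂, H u t ≤ BH := by
    intro u hu t ht
    have := hBH (u, t) ⟨hu, ht⟩
    rw [Function.uncurry_apply_pair, Real.norm_eq_abs] at this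
    exact (le_abs_self _).trans this
  have hBφ0 : 0 ≤ Bφ := (hφ0 T₁).trans (hφB T₁)
  have hBψ0 : 0 ≤ Bψ := (hψ0 a (left_mem_Icc.2 hab)).trans (hψB a (left_mem_Icc.2 hab))
  have hBH0 : 0 ≤ BH := (hH0 a T₁).trans (hBH' a (left_mem_Icc.2 hab) T₁ (left_mem_Icc.2 hT))
  -- the integrand on the rectangle and its measurability
  set F : ℝ → ℝ → ℝ := fun t u ↦ φ t * (ψ u * H u t) with hF
  have hHm : Measurable (Function.uncurry H) := hH.measurable
  have hFm : Measurable (Function.uncurry F) := by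
    have h1 : Measurable fun x : ℝ × ℝ ↦ H x.2 x.1 :=
      hHm.comp (measurable_snd.prodMk measurable_fst)
    exact (hφm.comp measurable_fst).mul ((hψm.comp measurable_snd).mul h1)
  haveI : IsFiniteMeasure (volume.restrict (Ioc T₁ T₂)) := inferInstance
  haveI : IsFiniteMeasure (volume.restrict (Ioc a b)) := inferInstance
  have hFint : Integrable (Function.uncurry F)
      ((volume.restrict (Ioc T₁ T₂)).prod (volume.restrict (Ioc a b))) := by
    refine (integrable_const (Bφ * (Bψ * BH))).mono' hFm.aestronglyMeasurable ?_
    rw [Measure.prod_restrict]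
    refine (ae_restrict_iff' (measurableSet_Ioc.prod measurableSet_Ioc)).2 (ae_of_all _ ?_)
    rintro ⟨t, u⟩ ⟨ht, hu⟩
    simp only [Function.uncurry_apply_pair, hF]
    have hu' : u ∈ Icc a b := Ioc_subset_Icc_self hu
    have ht' : t ∈ Icc T₁ T₂ := Ioc_subset_Icc_self ht
    rw [Real.norm_eq_abs, abs_of_nonneg (mul_nonneg (hφ0 _) (mul_nonneg (hψ0 _ hu') (hH0 _ _)))]
    exact mul_le_mul (hφB _) (mul_le_mul (hψB _ hu') (hBH' _ hu' _ ht') (hH0 _ _) hBψ0)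
      (mul_nonneg (hψ0 _ hu') (hH0 _ _)) hBφ0
  -- Step 1: rewrite the left side as an iterated integral and swap
  have hLHS : ∫ t in T₁..T₂, φ t * ∫ u in a..b, ψ u * H u t =
      ∫ t in Ioc T₁ T₂, ∫ u in Ioc a b, F t u := by
    rw [intervalIntegral.integral_of_le hT]
    refine integral_congr_ae (ae_of_all _ fun t ↦ ?_)
    simp only [hF]
    rw [intervalIntegral.integral_of_le hab, ← MeasureTheory.integral_const_mul]
  have hswap : ∫ t in Ioc T₁ T₂, ∫ u in Ioc a b, F t u = ∫ u in Ioc a b, ∫ t in Ioc T₁ T₂, F t u :=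
    integral_integral_swap hFint
  -- Step 2: for each `u ∈ [a, b]`, Cauchy–Schwarz in `t`
  have hinner : ∀ u ∈ Icc a b, ∫ t in Ioc T₁ T₂, F t u ≤ ψ u * (Real.sqrt Φ * Real.sqrt (G u)) := by
    intro u hu
    have e1 : ∫ t in Ioc T₁ T₂, F t u = ψ u * ∫ t in T₁..T₂, φ t * H u t := by
      simp only [hF]
      rw [intervalIntegral.integral_of_le hT, ← MeasureTheory.integral_const_mul]
      exact integral_congr_ae (ae_of_all _ fun t ↦ by ring)
    rw [e1]
    refine mul_le_mul_of_nonneg_left ?_ (hψ0 u hu)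
    have hHu : Measurable (H u) := hHm.comp (measurable_const.prodMk measurable_id)
    have hCS := integral_mul_le_sqrt_mul_sqrt hT hφm hHu hφ0 (hH0 u) (B := max Bφ BH)
      (fun t _ ↦ (hφB t).trans (le_max_left _ _))
      (fun t ht ↦ (hBH' u hu t (Ioc_subset_Icc_self ht)).trans (le_max_right _ _))
    exact hCS.trans (mul_le_mul (Real.sqrt_le_sqrt hΦ) (Real.sqrt_le_sqrt (hHG u hu))
      (Real.sqrt_nonneg _) (Real.sqrt_nonneg _))
  -- Step 3: integrate the bound over `u ∈ (a, b]`
  have hRint : IntegrableOn (fun u ↦ ψ u * (Real.sqrt Φ * Real.sqrt (G u))) (Ioc a b) volume := by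
    have hc : ContinuousOn (fun u ↦ ψ u * (Real.sqrt Φ * Real.sqrt (G u))) (Icc a b) :=
      hψc.mul (continuousOn_const.mul (continuous_sqrt.comp_continuousOn hG))
    exact (hc.integrableOn_Icc).mono_set Ioc_subset_Icc_self
  have hLint : IntegrableOn (fun u ↦ ∫ t in Ioc T₁ T₂, F t u) (Ioc a b) volume :=
    hFint.integral_prod_right
  have hmono : ∫ u in Ioc a b, ∫ t in Ioc T₁ T₂, F t u ≤
      ∫ u in Ioc a b, ψ u * (Real.sqrt Φ * Real.sqrt (G u)) :=
    setIntegral_mono_on hLint hRint measurableSet_Ioc fun u hu ↦ hinner u (Ioc_subset_Icc_self hu)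
  calc ∫ t in T₁..T₂, φ t * ∫ u in a..b, ψ u * H u t
      = ∫ u in Ioc a b, ∫ t in Ioc T₁ T₂, F t u := by rw [hLHS, hswap]
    _ ≤ ∫ u in Ioc a b, ψ u * (Real.sqrt Φ * Real.sqrt (G u)) := hmono
    _ = Real.sqrt Φ * ∫ u in a..b, ψ u * Real.sqrt (G u) := by
        rw [intervalIntegral.integral_of_le hab, ← MeasureTheory.integral_const_mul]
        exact integral_congr_ae (ae_of_all _ fun u ↦ by ring)

/-! ### Selberg's Dirichlet polynomials `Σ_n (−log n)^j w(n) n^{−1/2−u} n^{−it}` -/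

/-- **Selberg's Dirichlet polynomials in the moving abscissa** and their `u`-derivatives:
`P_j(S, w; u, t) = Σ_{n ∈ S} (−log n)^j w(n) n^{−1/2−u} n^{−it}` (`n^{−1/2−u} = e^{−(1/2+u) log n}`), so that
`∂_u P_j = P_{j+1}`. In Selberg's argument `S` is the set of primes `p < x³` (or of the higher prime
powers), `w(p) = f_x(log p)` (the weights `Literature.NumberTheory.LFunctions.SelbergExplicit.smoothing`) or
`w = 1_{p ≤ y}`, and `u = δ(t) = σ_{x,t} − 1/2`. [cite: Titchmarsh1986, §14.22] -/
def dirPoly (S : Finset ℕ) (w : ℕ → ℝ) (j : ℕ) (u t : ℝ) : ℂ :=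
  ∑ n ∈ S, (((-Real.log n) ^ j * w n * Real.exp (-((1 / 2 + u) * Real.log n)) : ℝ) : ℂ) *
    (n : ℂ) ^ (-((t : ℂ) * I))

/-- Unfolding lemma for `dirPoly`. [folklore] -/
theorem dirPoly_def (S : Finset ℕ) (w : ℕ → ℝ) (j : ℕ) (u t : ℝ) :
    dirPoly S w j u t = ∑ n ∈ S,
      (((-Real.log n) ^ j * w n * Real.exp (-((1 / 2 + u) * Real.log n)) : ℝ) : ℂ) *
        (n : ℂ) ^ (-((t : ℂ) * I)) := rfl

/-- `∂_u P_j = P_{j+1}`. [folklore] -/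
theorem hasDerivAt_dirPoly (S : Finset ℕ) (w : ℕ → ℝ) (j : ℕ) (u t : ℝ) :
    HasDerivAt (fun v ↦ dirPoly S w j v t) (dirPoly S w (j + 1) u t) u := by
  simp only [dirPoly_def]
  refine HasDerivAt.fun_sum fun n _ ↦ ?_
  have hcoef : HasDerivAt (fun v : ℝ ↦ (-Real.log n) ^ j * w n * Real.exp (-((1 / 2 + v) * Real.log n)))
      ((-Real.log n) ^ (j + 1) * w n * Real.exp (-((1 / 2 + u) * Real.log n))) u := by
    have h1 : HasDerivAt (fun v : ℝ ↦ -((1 / 2 + v) * Real.log n)) (-Real.log n) u := by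
      have h0 : HasDerivAt (fun v : ℝ ↦ -(Real.log n) * v + -(1 / 2 * Real.log n)) (-(Real.log n) * 1) u :=
        ((hasDerivAt_id u).const_mul (-(Real.log n))).add_const _
      have e : (fun v : ℝ ↦ -((1 / 2 + v) * Real.log n)) = fun v : ℝ ↦ -(Real.log n) * v + -(1 / 2 * Real.log n) := by
        funext v; ring
      rw [e]
      exact h0.congr_deriv (by ring)
    have h2 := (h1.exp).const_mul ((-Real.log n) ^ j * w n)
    rw [show (-Real.log n) ^ j * w n * (Real.exp (-((1 / 2 + u) * Real.log n)) * -Real.log n) =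
      (-Real.log n) ^ (j + 1) * w n * Real.exp (-((1 / 2 + u) * Real.log n)) by rw [pow_succ]; ring] at h2
    exact h2
  exact hcoef.ofReal_comp.mul_const _

/-- Joint continuity of `(u, t) ↦ P_j(S, w; u, t)` (`0 ∉ S`). [folklore] -/
theorem continuous_dirPoly {S : Finset ℕ} (hS : ∀ n ∈ S, n ≠ 0) (w : ℕ → ℝ) (j : ℕ) :
    Continuous fun x : ℝ × ℝ ↦ dirPoly S w j x.1 x.2 := by
  simp only [dirPoly_def]
  refine continuous_finsetSum _ fun n hn ↦ ?_
  have h1 : Continuous fun x : ℝ × ℝ ↦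
      (((-Real.log n) ^ j * w n * Real.exp (-((1 / 2 + x.1) * Real.log n)) : ℝ) : ℂ) :=
    Complex.continuous_ofReal.comp (by fun_prop)
  have h2 : Continuous fun x : ℝ × ℝ ↦ (n : ℂ) ^ (-((x.2 : ℂ) * I)) := by
    simp_rw [natCast_cpow_neg_mul_I (hS n hn)]
    fun_prop
  exact h1.mul h2

set_option maxHeartbeats 1000000 in
/-- Measurability of `t ↦ P_j(S, w; d(t), t)` along a measurable abscissa `d` (`0 ∉ S`). [folklore] -/
theorem measurable_dirPoly_comp {S : Finset ℕ} (hS : ∀ n ∈ S, n ≠ 0) (w : ℕ → ℝ) (j : ℕ) {d : ℝ → ℝ}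
    (hd : Measurable d) : Measurable fun t : ℝ ↦ dirPoly S w j (d t) t := by
  have h1 : Measurable fun x : ℝ × ℝ ↦ dirPoly S w j x.1 x.2 := (continuous_dirPoly hS w j).measurable
  have h2 : Measurable fun t : ℝ ↦ (d t, t) := hd.prodMk measurable_id
  have h3 := h1.comp h2
  simpa only [Function.comp_def] using h3

/-- The size of one coefficient, squared: `‖(−log n)^j w(n) e^{−(1/2+u) log n}‖² = (log n)^{2j} w(n)² n^{−(1+2u)}`
(`n ≥ 1`). [folklore] -/
theorem norm_sq_coeff {n : ℕ} (hn : n ≠ 0) (w : ℕ → ℝ) (j : ℕ) (u : ℝ) :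
    ‖(((-Real.log n) ^ j * w n * Real.exp (-((1 / 2 + u) * Real.log n)) : ℝ) : ℂ)‖ ^ 2 =
      Real.log n ^ (2 * j) * w n ^ 2 * (n : ℝ) ^ (-(1 + 2 * u)) := by
  have hn0 : (0 : ℝ) < n := by exact_mod_cast Nat.pos_of_ne_zero hn
  rw [Complex.norm_real, Real.norm_eq_abs, sq_abs, mul_pow, mul_pow, ← pow_mul, neg_pow,
    Real.rpow_def_of_pos hn0, ← Real.exp_nat_mul]
  have h1 : ((-1 : ℝ)) ^ (j * 2) = 1 := by rw [mul_comm, pow_mul, neg_one_sq, one_pow]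
  rw [h1, one_mul, mul_comm j 2]
  congr 2
  push_cast
  ring

/-- The coefficient norm: `‖(−log n)^j w(n) e^{−(1/2+u) log n} · n^{−it}‖ ≤ (log n)^j |w n|` for `u ≥ −1/2`
(`n ≥ 1`). [folklore] -/
theorem norm_coeff_mul_le {n : ℕ} (hn : n ≠ 0) (w : ℕ → ℝ) (j : ℕ) {u : ℝ} (hu : -(1 / 2 : ℝ) ≤ u) (t : ℝ) :
    ‖(((-Real.log n) ^ j * w n * Real.exp (-((1 / 2 + u) * Real.log n)) : ℝ) : ℂ) *
        (n : ℂ) ^ (-((t : ℂ) * I))‖ ≤ Real.log n ^ j * |w n| := by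
  have hn1 : (1 : ℝ) ≤ n := by exact_mod_cast Nat.pos_of_ne_zero hn
  have hlog : 0 ≤ Real.log n := Real.log_nonneg hn1
  rw [norm_mul, natCast_cpow_neg_mul_I hn, Complex.norm_exp_ofReal_mul_I, mul_one, Complex.norm_real,
    Real.norm_eq_abs, abs_mul, abs_mul, abs_pow, abs_neg, abs_of_nonneg hlog,
    abs_of_nonneg (Real.exp_pos _).le]
  have hexp : Real.exp (-((1 / 2 + u) * Real.log n)) ≤ 1 := by
    rw [Real.exp_le_one_iff]
    have : 0 ≤ (1 / 2 + u) * Real.log n := mul_nonneg (by linarith) hlog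
    linarith
  calc Real.log n ^ j * |w n| * Real.exp (-((1 / 2 + u) * Real.log n))
      ≤ Real.log n ^ j * |w n| * 1 := by gcongr
    _ = Real.log n ^ j * |w n| := mul_one _

/-- A bound for `P_j` uniform in `t` and in `u ≥ −1/2`: `‖P_j(S, w; u, t)‖ ≤ Σ_{n ∈ S} (log n)^j |w(n)|`
(`0 ∉ S`). [folklore] -/
theorem norm_dirPoly_le {S : Finset ℕ} (hS : ∀ n ∈ S, n ≠ 0) (w : ℕ → ℝ) (j : ℕ) {u : ℝ}
    (hu : -(1 / 2 : ℝ) ≤ u) (t : ℝ) :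
    ‖dirPoly S w j u t‖ ≤ ∑ n ∈ S, Real.log n ^ j * |w n| := by
  rw [dirPoly_def]
  exact (norm_sum_le _ _).trans (Finset.sum_le_sum fun n hn ↦ norm_coeff_mul_le (hS n hn) w j hu t)

/-- The sum of the squared coefficients of `P_j(S, w; u, ·)`:
`Σ_n ‖coeff_n‖² = Σ_n (log n)^{2j} w(n)² n^{−(1+2u)}` (`0 ∉ S`). [folklore] -/
theorem sum_norm_sq_coeff {S : Finset ℕ} (hS : ∀ n ∈ S, n ≠ 0) (w : ℕ → ℝ) (j : ℕ) (u : ℝ) :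
    ∑ n ∈ S, ‖(((-Real.log n) ^ j * w n * Real.exp (-((1 / 2 + u) * Real.log n)) : ℝ) : ℂ)‖ ^ 2 =
      ∑ n ∈ S, Real.log n ^ (2 * j) * w n ^ 2 * (n : ℝ) ^ (-(1 + 2 * u)) :=
  Finset.sum_congr rfl fun n hn ↦ norm_sq_coeff (hS n hn) w j u

/-- Linearity in the weight: `P_j(S, w₁; u, t) − P_j(S, w₂; u, t) = P_j(S, w₁ − w₂; u, t)`. [folklore] -/
theorem dirPoly_sub (S : Finset ℕ) (w₁ w₂ : ℕ → ℝ) (j : ℕ) (u t : ℝ) :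
    dirPoly S w₁ j u t - dirPoly S w₂ j u t = dirPoly S (fun n ↦ w₁ n - w₂ n) j u t := by
  simp only [dirPoly_def, ← Finset.sum_sub_distrib]
  refine Finset.sum_congr rfl fun n _ ↦ ?_
  push_cast
  ring

/-- Shifting the abscissa into the weight: `P_j(S, w; u + v, t) = P_j(S, w · e^{−v log ·}; u, t)`. [folklore] -/
theorem dirPoly_add (S : Finset ℕ) (w : ℕ → ℝ) (j : ℕ) (u v t : ℝ) :
    dirPoly S w j (u + v) t = dirPoly S (fun n ↦ w n * Real.exp (-(v * Real.log n))) j u t := by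
  simp only [dirPoly_def]
  refine Finset.sum_congr rfl fun n _ ↦ ?_
  have e : (-Real.log n) ^ j * w n * Real.exp (-((1 / 2 + (u + v)) * Real.log n)) =
      (-Real.log n) ^ j * (w n * Real.exp (-(v * Real.log n))) * Real.exp (-((1 / 2 + u) * Real.log n)) := by
    rw [show -((1 / 2 + (u + v)) * Real.log n) = -(v * Real.log n) + -((1 / 2 + u) * Real.log n) by ring,
      Real.exp_add]
    ring
  rw [e]

/-- **Mean square of `P_j` on `[T/2, T]`** for `S ⊆ [1, N]`:
`∫_{T/2}^{T} ‖P_j(S, w; u, t)‖² dt ≤ (T/2 + 8N(1 + log N)) Σ_{n ∈ S} (log n)^{2j} w(n)² n^{−(1+2u)}`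
(the crude mean value theorem for Dirichlet polynomials, coefficients extended by zero).
[cite: Titchmarsh1986, §7.2] -/
theorem integral_norm_sq_dirPoly_le {S : Finset ℕ} {N : ℕ} (hS : S ⊆ Finset.Icc 1 N) (w : ℕ → ℝ) (j : ℕ)
    (u T : ℝ) :
    ∫ t in T / 2..T, ‖dirPoly S w j u t‖ ^ 2 ≤
      (T / 2 + 8 * N * (1 + Real.log N)) *
        ∑ n ∈ S, Real.log n ^ (2 * j) * w n ^ 2 * (n : ℝ) ^ (-(1 + 2 * u)) := by
  classical
  have hS0 : ∀ n ∈ S, n ≠ 0 := fun n hn ↦ by have := (Finset.mem_Icc.1 (hS hn)).1; omega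
  set a : ℕ → ℂ := fun n ↦ if n ∈ S then
    (((-Real.log n) ^ j * w n * Real.exp (-((1 / 2 + u) * Real.log n)) : ℝ) : ℂ) else 0 with ha
  have hsum : ∀ t : ℝ, dirPoly S w j u t = ∑ n ∈ Finset.Icc 1 N, a n * (n : ℂ) ^ (-((t : ℂ) * I)) := by
    intro t
    rw [dirPoly_def]
    have : ∑ n ∈ Finset.Icc 1 N, a n * (n : ℂ) ^ (-((t : ℂ) * I)) =
        ∑ n ∈ Finset.Icc 1 N, if n ∈ S then
          (((-Real.log n) ^ j * w n * Real.exp (-((1 / 2 + u) * Real.log n)) : ℝ) : ℂ) *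
            (n : ℂ) ^ (-((t : ℂ) * I)) else 0 :=
      Finset.sum_congr rfl fun n _ ↦ by simp only [ha]; split_ifs <;> simp
    rw [this, Finset.sum_ite_mem, Finset.inter_eq_right.2 hS]
  have hnorm : ∑ n ∈ Finset.Icc 1 N, ‖a n‖ ^ 2 =
      ∑ n ∈ S, Real.log n ^ (2 * j) * w n ^ 2 * (n : ℝ) ^ (-(1 + 2 * u)) := by
    have : ∑ n ∈ Finset.Icc 1 N, ‖a n‖ ^ 2 = ∑ n ∈ Finset.Icc 1 N, if n ∈ S then
        ‖(((-Real.log n) ^ j * w n * Real.exp (-((1 / 2 + u) * Real.log n)) : ℝ) : ℂ)‖ ^ 2 else 0 :=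
      Finset.sum_congr rfl fun n _ ↦ by simp only [ha]; split_ifs <;> simp
    rw [this, Finset.sum_ite_mem, Finset.inter_eq_right.2 hS]
    exact sum_norm_sq_coeff hS0 w j u
  have h := SelbergFujii.abs_integral_norm_sq_dirichletSum_sub_le a N (T / 2)
  rw [show 2 * (T / 2) = T by ring, hnorm, abs_le] at h
  simp_rw [hsum]
  have h0 : 0 ≤ ∑ n ∈ S, Real.log n ^ (2 * j) * w n ^ 2 * (n : ℝ) ^ (-(1 + 2 * u)) :=
    Finset.sum_nonneg fun n _ ↦ by
      have hl : 0 ≤ Real.log n := Real.log_natCast_nonneg n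
      have : 0 ≤ (n : ℝ) ^ (-(1 + 2 * u)) := Real.rpow_nonneg (Nat.cast_nonneg n) _
      positivity
  nlinarith [h.2]

/-- **Fourth moment of the prime polynomial `P_j` on `[T/2, T]`** (`T ≥ 0`):
`∫_{T/2}^{T} ‖P_j(primes ≤ N, w; u, t)‖⁴ dt ≤ (T/2 + 8N²(1 + log N²)) · 2 (Σ_p (log p)^{2j} w(p)² p^{−(1+2u)})²`.
[cite: Titchmarsh1986, §7.2] -/
theorem integral_norm_dirPoly_pow_four_le (N : ℕ) (w : ℕ → ℝ) (j : ℕ) (u : ℝ) {T : ℝ} (hT : 0 ≤ T) :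
    ∫ t in T / 2..T, ‖dirPoly (Nat.primesLE N) w j u t‖ ^ 4 ≤
      (T / 2 + 8 * (N : ℝ) ^ 2 * (1 + Real.log ((N : ℝ) ^ 2))) *
        (2 * (∑ p ∈ Nat.primesLE N, Real.log p ^ (2 * j) * w p ^ 2 * (p : ℝ) ^ (-(1 + 2 * u))) ^ 2) := by
  have hS0 : ∀ n ∈ Nat.primesLE N, n ≠ 0 := fun n hn ↦ (Nat.mem_primesLE.1 hn).2.ne_zero
  have h := SelbergFujii.integral_norm_primeSum_pow_four_le N
    (fun p ↦ (((-Real.log p) ^ j * w p * Real.exp (-((1 / 2 + u) * Real.log p)) : ℝ) : ℂ))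
    (show 0 ≤ T / 2 by linarith)
  rw [show 2 * (T / 2) = T by ring, sum_norm_sq_coeff hS0] at h
  simp only [dirPoly_def]
  exact h

end SelbergEngine

end Literature.NumberTheory.LFunctions

end
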